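import Mathlib
import Literature.Analysis.FluidPDE.LoopCirculation
import Literature.Analysis.Calculus.PoincareLemmaOneForm
import HarnessLib

/-!
# Route `TautLoopKelvin`, crux `TautLoopLaw` (stmt-NavierStokesRegularity-15249), line
  `Sketch-ideas-r1k1` — tools for `stub_tautLoopLevelLeftContinuity`, part 3: circulations in a
  chain of curl-free balls

Where `curl v = 0` the `C¹` field `v` has local potentials on balls (the tree's Poincaré lemma
`Literature.Analysis.Calculus.hasFDerivAt_radialIntegral` applied to the `1`-form `⟪v, ·⟫`, whose
derivative is symmetric exactly when `curl v = 0`, `inner_curl_cross`). Along a `C¹` arc inside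
such a ball the circulation integrand integrates to the difference of the potential
(`tautLoopLlc_integral_arc`); two potentials differ by a constant on the (convex) overlap of two
balls. Consequently (`tautLoopLlc_circulation_mem_chain`): for a finite family of centres `C`, a
closed `C¹` loop covered by the balls `B(c, R/3)` and of length `≤ N R / 3` (cut into `N` arcs of
equal length, `tautLoopLlc_subdivision`) has circulation equal to a sum of `N` transition constants,
hence lying in a finite set determined by `C`, `R`, `N` alone. From this, circulations of a
confined sequence of loops near which the vorticity becomes uniformly small eventually take only
finitely many values (`tautLoopLlc_quantised`). Folklore; all proved.
-/

noncomputable section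

open Set MeasureTheory Filter Topology Function Real intervalIntegral Metric
  Literature.Analysis.FluidPDE
open scoped InnerProductSpace RealInnerProductSpace

namespace Summit.NavierStokesRegularity.NavierStokesRegularity.Theorems

set_option linter.dupNamespace false

local notation3 "E3" => EuclideanSpace ℝ (Fin 3)

/-! ## Local potentials -/

/-- **Local potentials of a curl-free field.** If the `C¹` field `v` has `curl v = 0` on the ball
`B(c, R)`, the radial integral `y ↦ ∫₀¹ ⟪v (c + t (y - c)), y - c⟫ dt` has gradient `v` there
(Poincaré lemma for the `1`-form `⟪v, ·⟫`; its derivative `(a, b) ↦ ⟪Dv a, b⟫` is symmetric since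
`⟪curl v, a × b⟫ = ⟪Dv a, b⟫ - ⟪Dv b, a⟫`). [folklore] -/
theorem tautLoopLlc_potential {v : E3 → E3} (hv : ContDiff ℝ 1 v) {c : E3} {R : ℝ}
    (hcurl : ∀ x ∈ ball c R, curl v x = 0) {x : E3} (hx : x ∈ ball c R) :
    HasFDerivAt (fun y => ∫ t in (0:ℝ)..1, ⟪v (c + t • (y - c)), y - c⟫) (innerSL ℝ (v x)) x := by
  have hA : ContDiffOn ℝ 1 (fun y => innerSL ℝ (v y)) (ball c R) :=
    ((innerSL ℝ : E3 →L[ℝ] E3 →L[ℝ] ℝ).contDiff.comp hv).contDiffOn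
  have hD : ∀ z, fderiv ℝ (fun y => innerSL ℝ (v y)) z =
      (innerSL ℝ : E3 →L[ℝ] E3 →L[ℝ] ℝ).comp (fderiv ℝ v z) := fun z =>
    ((innerSL ℝ : E3 →L[ℝ] E3 →L[ℝ] ℝ).hasFDerivAt.comp z
      (hv.differentiable one_ne_zero z).hasFDerivAt).fderiv
  have hsymm : ∀ z ∈ ball c R, ∀ a b : E3,
      fderiv ℝ (fun y => innerSL ℝ (v y)) z a b = fderiv ℝ (fun y => innerSL ℝ (v y)) z b a := by
    intro z hz a b
    rw [hD z]
    simp only [ContinuousLinearMap.comp_apply, innerSL_apply_apply]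
    have h := inner_curl_cross v z a b
    rw [hcurl z hz, inner_zero_left] at h
    linarith
  have h := Literature.Analysis.Calculus.hasFDerivAt_radialIntegral hA hsymm hx
  simpa only [innerSL_apply_apply] using h

/-- **Fundamental theorem of calculus along an arc.** If `φ` has gradient `v` at the points of a
`C¹` arc `β|[a, b]`, then `∫ₐᵇ ⟪v (β s), β′ s⟫ ds = φ (β b) - φ (β a)`. [folklore] -/
theorem tautLoopLlc_integral_arc {v : E3 → E3} (hv : Continuous v) {β : ℝ → E3}
    (hβ : ContDiff ℝ 1 β) {φ : E3 → ℝ} {a b : ℝ}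
    (hφ : ∀ s ∈ uIcc a b, HasFDerivAt φ (innerSL ℝ (v (β s))) (β s)) :
    ∫ s in a..b, ⟪v (β s), deriv β s⟫ = φ (β b) - φ (β a) := by
  have hd : ∀ s ∈ uIcc a b, HasDerivAt (φ ∘ β) ⟪v (β s), deriv β s⟫ s := by
    intro s hs
    have h := (hφ s hs).comp_hasDerivAt s (hβ.differentiable one_ne_zero s).hasDerivAt
    simpa only [innerSL_apply_apply] using h
  rw [integral_eq_sub_of_hasDerivAt hd (intervalIntegrable_inner_deriv hv hβ a b)]
  rfl

/-- Two potentials of the same field on an open convex set differ by a constant. [folklore] -/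
theorem tautLoopLlc_potential_sub_const {v : E3 → E3} {φ ψ : E3 → ℝ} {U : Set E3}
    (hU : IsOpen U) (hUc : Convex ℝ U)
    (hφ : ∀ x ∈ U, HasFDerivAt φ (innerSL ℝ (v x)) x)
    (hψ : ∀ x ∈ U, HasFDerivAt ψ (innerSL ℝ (v x)) x)
    {x y : E3} (hx : x ∈ U) (hy : y ∈ U) : φ x - ψ x = φ y - ψ y := by
  have hd : ∀ z ∈ U, HasFDerivAt (fun z => φ z - ψ z) (0 : E3 →L[ℝ] ℝ) z := fun z hz => by
    have h := (hφ z hz).sub (hψ z hz)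
    rwa [sub_self] at h
  exact hUc.is_const_of_fderivWithin_eq_zero
    (fun z hz => (hd z hz).differentiableAt.differentiableWithinAt)
    (fun z hz => by rw [fderivWithin_of_isOpen hU hz, (hd z hz).fderiv]) hx hy

/-! ## Equal arc-length subdivision -/

/-- **Equal arc-length subdivision.** A `C¹` curve on `[0, 1]` can be cut at parameters
`0 = t₀, t₁, …, t_N = 1` into `N ≥ 1` arcs along each of which the curve stays within `len / N` of
the arc's starting point (cut the nondecreasing continuous arc length `s ↦ ∫₀ˢ ‖β′‖` at the levels
`j · len / N`, intermediate value theorem). [folklore] -/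
theorem tautLoopLlc_subdivision {β : ℝ → E3} (hβ : ContDiff ℝ 1 β) {N : ℕ} (hN : 0 < N) :
    ∃ t : ℕ → ℝ, t 0 = 0 ∧ t N = 1 ∧
      ∀ j < N, ∀ s ∈ uIcc (t j) (t (j + 1)),
        ‖β s - β (t j)‖ ≤ (∫ σ in (0:ℝ)..1, ‖deriv β σ‖) / N := by
  set A : ℝ → ℝ := fun s => ∫ σ in (0:ℝ)..s, ‖deriv β σ‖ with hA
  have hcd : Continuous fun σ => ‖deriv β σ‖ := (hβ.continuous_deriv le_rfl).norm
  have hI : ∀ a b, IntervalIntegrable (fun σ => ‖deriv β σ‖) volume a b := fun a b =>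
    hcd.intervalIntegrable a b
  have hAc : Continuous A := intervalIntegral.continuous_primitive hI 0
  have hAsub : ∀ s₁ s₂, A s₂ - A s₁ = ∫ σ in s₁..s₂, ‖deriv β σ‖ := fun s₁ s₂ =>
    integral_interval_sub_left (hI _ _) (hI _ _)
  have hAmono : Monotone A := fun s₁ s₂ h12 => by
    have h2 : 0 ≤ ∫ σ in s₁..s₂, ‖deriv β σ‖ :=
      intervalIntegral.integral_nonneg h12 fun σ _ => norm_nonneg _
    linarith [hAsub s₁ s₂]
  have hA0 : A 0 = 0 := by simp [hA]
  have hA1 : 0 ≤ A 1 := by rw [← hA0]; exact hAmono zero_le_one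
  have hNr : (0:ℝ) < N := by exact_mod_cast hN
  -- the cut parameters
  have hex : ∀ j : ℕ, ∃ t : ℝ, (j ≤ N → t ∈ Icc (0:ℝ) 1 ∧ A t = j * (A 1 / N)) ∧
      (j = 0 → t = 0) ∧ (j = N → t = 1) := by
    intro j
    by_cases hj0 : j = 0
    · refine ⟨0, fun _ => ⟨⟨le_rfl, zero_le_one⟩, by simp [hj0, hA0]⟩, fun _ => rfl, fun h => ?_⟩
      omega
    by_cases hjN : j = N
    · refine ⟨1, fun _ => ⟨⟨zero_le_one, le_rfl⟩, ?_⟩, fun h => absurd h hj0, fun _ => rfl⟩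
      rw [hjN]
      field_simp
    by_cases hjle : j ≤ N
    · have hmem : (j : ℝ) * (A 1 / N) ∈ Icc (A 0) (A 1) := by
        rw [hA0]
        refine ⟨by positivity, ?_⟩
        have hj' : (j : ℝ) ≤ N := by exact_mod_cast hjle
        calc (j : ℝ) * (A 1 / N) ≤ N * (A 1 / N) := by gcongr
          _ = A 1 := by field_simp
      obtain ⟨t, ht, hAt⟩ := intermediate_value_Icc zero_le_one hAc.continuousOn hmem
      exact ⟨t, fun _ => ⟨ht, hAt⟩, fun h => absurd h hj0, fun h => absurd h hjN⟩
    · exact ⟨0, fun h => absurd h hjle, fun h => absurd h hj0, fun h => absurd h hjN⟩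
  choose t ht using hex
  refine ⟨t, (ht 0).2.1 rfl, (ht N).2.2 rfl, fun j hj s hs => ?_⟩
  have hj1 := (ht j).1 hj.le
  have hj2 := (ht (j + 1)).1 hj
  have hFTC : ∫ σ in (t j)..s, deriv β σ = β s - β (t j) :=
    integral_deriv_eq_sub (fun x _ => hβ.differentiable one_ne_zero x)
      ((hβ.continuous_deriv le_rfl).intervalIntegrable _ _)
  calc ‖β s - β (t j)‖ = ‖∫ σ in (t j)..s, deriv β σ‖ := by rw [hFTC]
    _ ≤ |∫ σ in (t j)..s, ‖deriv β σ‖| := norm_integral_le_abs_integral_norm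
    _ = |A s - A (t j)| := by rw [hAsub]
    _ ≤ |A (t (j + 1)) - A (t j)| :=
        abs_sub_left_of_mem_uIcc (hAmono.image_uIcc_subset ⟨s, hs, rfl⟩)
    _ = (∫ σ in (0:ℝ)..1, ‖deriv β σ‖) / N := by
        rw [hj2.2, hj1.2, Nat.cast_add, Nat.cast_one,
          show ((j:ℝ) + 1) * (A 1 / N) - j * (A 1 / N) = A 1 / N by ring,
          abs_of_nonneg (div_nonneg hA1 hNr.le)]

/-! ## Circulations in a chain of balls carrying potentials -/

/-- **Circulation of a short-step loop in a chain of balls with potentials.** Let `C` be a finite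
set of centres, `φ c` a potential of the continuous field `v` on `B(c, R)` for `c ∈ C`, and
`K c c'` constants with `φ c = φ c' + K c c'` on `B(c, R) ∩ B(c', R)`. A closed `C¹` loop `β` each
of whose points is within `R/3` of some centre and whose length is at most `N R / 3` (`N ≥ 1`) has
circulation `∑_{j<N} K (a j) (a (j+1))` for some cyclic chain of centres `a : Fin (N+1) → C`:
cut `β` into `N` arcs of length `≤ R/3`; arc `j` starts within `R/3` of a centre `a j` and stays in
`B(a j, R)`, so it contributes `φ (a j) (end) - φ (a j) (start)`; consecutive ends lie in the overlap
of consecutive balls, and the sum telescopes around the closed loop. [folklore] -/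
theorem tautLoopLlc_circulation_mem_chain {v : E3 → E3} (hv : Continuous v) (C : Finset E3)
    {R : ℝ} (φ K : E3 → E3 → ℝ)
    (hφ : ∀ c ∈ C, ∀ x ∈ ball c R, HasFDerivAt (φ c) (innerSL ℝ (v x)) x)
    (hK : ∀ c ∈ C, ∀ c' ∈ C, ∀ p ∈ ball c R ∩ ball c' R, φ c p = φ c' p + K c c')
    {N : ℕ} (hN : 0 < N) {β : ℝ → E3} (hβ : IsC1Loop β)
    (hcov : ∀ s, ∃ c ∈ C, dist (β s) c < R / 3)
    (hlen : (∫ σ in (0:ℝ)..1, ‖deriv β σ‖) ≤ N * (R / 3)) :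
    circulation v β ∈ Set.range (fun b : Fin (N + 1) → ↥C =>
      ∑ j : Fin N, K (b (Fin.castSucc j)) (b (Fin.succ j))) := by
  obtain ⟨t, ht0, htN, hstep⟩ := tautLoopLlc_subdivision hβ.contDiff hN
  have hNr : (0:ℝ) < N := by exact_mod_cast hN
  have hstep' : ∀ j < N, ∀ s ∈ uIcc (t j) (t (j + 1)), ‖β s - β (t j)‖ ≤ R / 3 :=
    fun j hj s hs => (hstep j hj s hs).trans (by rw [div_le_iff₀ hNr]; linarith)
  choose cc hccC hccd using hcov
  have hR : 0 < R := by linarith [hccd 0, dist_nonneg (x := β 0) (y := cc 0)]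
  -- centres along the subdivision, closed up cyclically
  set a : ℕ → E3 := fun j => cc (t (j % N)) with ha
  have haC : ∀ j, a j ∈ C := fun j => hccC _
  have haN : a N = a 0 := by simp [ha, Nat.mod_self, Nat.zero_mod]
  have halt : ∀ j < N, a j = cc (t j) := fun j hj => by simp [ha, Nat.mod_eq_of_lt hj]
  -- each arc stays in the ball of its centre
  have hin : ∀ j < N, ∀ s ∈ uIcc (t j) (t (j + 1)), β s ∈ ball (a j) R := by
    intro j hj s hs
    rw [halt j hj, mem_ball]
    calc dist (β s) (cc (t j)) ≤ dist (β s) (β (t j)) + dist (β (t j)) (cc (t j)) :=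
          dist_triangle _ _ _
      _ < R / 3 + R / 3 := by
          rw [dist_eq_norm]
          exact add_lt_add_of_le_of_lt (hstep' j hj s hs) (hccd _)
      _ ≤ R := by linarith
  have hpiece : ∀ j < N, ∫ s in (t j)..(t (j + 1)), ⟪v (β s), deriv β s⟫ =
      φ (a j) (β (t (j + 1))) - φ (a j) (β (t j)) := fun j hj =>
    tautLoopLlc_integral_arc hv hβ.contDiff (fun s hs => hφ _ (haC j) _ (hin j hj s hs))
  -- consecutive ends lie in the overlap of consecutive balls
  have hnext : ∀ j < N, β (t (j + 1)) ∈ ball (a j) R ∩ ball (a (j + 1)) R := by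
    intro j hj
    refine ⟨hin j hj _ right_mem_uIcc, ?_⟩
    by_cases hj1 : j + 1 < N
    · exact hin (j + 1) hj1 _ left_mem_uIcc
    · have hj1' : j + 1 = N := by omega
      have h10 : β (t (j + 1)) = β (t 0) := by
        rw [hj1', htN, ht0]
        exact hβ.apply_zero_eq_apply_one.symm
      rw [h10, hj1', haN]
      exact hin 0 hN _ left_mem_uIcc
  -- split the circulation along the subdivision and telescope
  have hsum : circulation v β =
      ∑ j ∈ Finset.range N, (φ (a j) (β (t (j + 1))) - φ (a j) (β (t j))) := by
    have hadj := sum_integral_adjacent_intervals (μ := volume)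
      (f := fun s => ⟪v (β s), deriv β s⟫) (a := t) (n := N)
      (fun k _ => intervalIntegrable_inner_deriv hv hβ.contDiff _ _)
    rw [ht0, htN] at hadj
    unfold circulation
    rw [← hadj]
    exact Finset.sum_congr rfl fun j hj => hpiece j (Finset.mem_range.1 hj)
  have hterm : ∀ j ∈ Finset.range N, φ (a j) (β (t (j + 1))) - φ (a j) (β (t j)) =
      K (a j) (a (j + 1)) + (φ (a (j + 1)) (β (t (j + 1))) - φ (a j) (β (t j))) := by
    intro j hj
    rw [hK _ (haC j) _ (haC (j + 1)) _ (hnext j (Finset.mem_range.1 hj))]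
    ring
  rw [hsum, Finset.sum_congr rfl hterm, Finset.sum_add_distrib,
    Finset.sum_range_sub (fun j => φ (a j) (β (t j))), htN, haN, ht0,
    ← hβ.apply_zero_eq_apply_one, sub_self, add_zero]
  refine ⟨fun i => ⟨a i, haC i⟩, ?_⟩
  simp only [Fin.val_castSucc, Fin.val_succ]
  rw [Finset.sum_range]

/-! ## Case B2 of the stub: quantised circulations near a vorticity-free limit set -/

/-- **Quantisation of circulations.** Let `v` be `C¹` and let `γₙ` be closed `C¹` loops in a fixed
ball, of bounded length, such that for some `d₀ > 0` the vorticity becomes uniformly small on the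
`d₀`-neighbourhood of `γₙ` as `n → ∞`. Then the circulations `∮_{γₙ} v` eventually lie in a finite
set. Proof: on the `d₀`-neighbourhood of the limit set `S` of the sequence `curl v` vanishes;
eventually `γₙ` lies within `d₀/3` of `S` (Bolzano–Weierstrass); cover by finitely many balls of
radius `d₀/6` centred within `d₀/2` of `S`, take the radial potentials on the concentric balls of
radius `d₀/2` and apply `tautLoopLlc_circulation_mem_chain`. [folklore] -/
theorem tautLoopLlc_quantised {v : E3 → E3} (hv : ContDiff ℝ 1 v) {γ : ℕ → ℝ → E3}
    (hγ : ∀ n, IsC1Loop (γ n)) {R₀ ℓ d₀ : ℝ} (hR : ∀ n s, ‖γ n s‖ ≤ R₀)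
    (hℓ : ∀ n, (∫ σ in (0:ℝ)..1, ‖deriv (γ n) σ‖) ≤ ℓ) (hd₀ : 0 < d₀)
    (hflat : ∀ w : ℝ, 0 < w → ∀ᶠ n in atTop, ∀ (x : E3) (s : ℝ),
      dist x (γ n s) ≤ d₀ → ‖curl v x‖ < w) :
    ∃ V : Set ℝ, V.Finite ∧ ∀ᶠ n in atTop, circulation v (γ n) ∈ V := by
  classical
  -- the limit set of the sequence of loops
  set S : Set E3 := {x | ∀ ε > 0, ∃ᶠ n in atTop, ∃ s, dist x (γ n s) < ε} with hS
  -- (a) the vorticity vanishes within `d₀` of `S`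
  have hcurl0 : ∀ x : E3, (∃ y ∈ S, dist x y < d₀) → curl v x = 0 := by
    rintro x ⟨y, hy, hxy⟩
    by_contra hne
    have hw : 0 < ‖curl v x‖ := norm_pos_iff.2 hne
    obtain ⟨n, ⟨s, hs⟩, hn⟩ :=
      ((hy (d₀ - dist x y) (sub_pos.2 hxy)).and_eventually (hflat _ hw)).exists
    have h := hn x s (by linarith [dist_triangle x y (γ n s)])
    exact lt_irrefl _ h
  -- (b) eventually every point of `γ n` is within `d₀/3` of `S`
  have hnearS : ∀ᶠ n in atTop, ∀ s, ∃ y ∈ S, dist (γ n s) y < d₀ / 3 := by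
    by_contra hcon
    obtain ⟨φ, hφ, hbad⟩ := extraction_of_frequently_atTop (Filter.not_eventually.1 hcon)
    simp only [not_forall, not_exists, not_and, not_lt] at hbad
    choose sb hsb using hbad
    obtain ⟨z, -, ψ, hψ, hlim⟩ := (isCompact_closedBall (0:E3) R₀).tendsto_subseq
      (x := fun k => γ (φ k) (sb k)) (fun k => mem_closedBall_zero_iff.2 (hR _ _))
    have hd : ∀ ε > 0, ∀ᶠ k in atTop, dist (γ (φ (ψ k)) (sb (ψ k))) z < ε := fun ε hε => by
      simpa using (Metric.tendsto_nhds.1 hlim) ε hε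
    have hz : z ∈ S := by
      intro ε hε
      rw [Filter.frequently_atTop]
      intro N₀
      obtain ⟨k, hk1, hk2⟩ := ((hd ε hε).and (eventually_ge_atTop N₀)).exists
      refine ⟨φ (ψ k), hk2.trans ((hφ.comp hψ).id_le k), sb (ψ k), ?_⟩
      rwa [dist_comm]
    obtain ⟨k, hk⟩ := (hd _ (by positivity : (0:ℝ) < d₀ / 3)).exists
    exact (not_lt.2 (hsb (ψ k) z hz)) hk
  -- (c) a finite cover by small balls centred near `S`, with potentials
  obtain ⟨T, -, hTfin, hTcov⟩ :=
    (isCompact_closedBall (0:E3) R₀).finite_cover_balls (e := d₀ / 6) (by positivity)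
  set C : Finset E3 := hTfin.toFinset.filter (fun c => ∃ y ∈ S, dist c y < d₀ / 2) with hC
  set R : ℝ := d₀ / 2 with hRdef
  have hCS : ∀ c ∈ C, ∀ x ∈ ball c R, curl v x = 0 := by
    intro c hc x hx
    obtain ⟨y, hy, hcy⟩ := (Finset.mem_filter.1 hc).2
    refine hcurl0 x ⟨y, hy, ?_⟩
    rw [mem_ball] at hx
    linarith [dist_triangle x c y]
  set Φ : E3 → E3 → ℝ := fun c y => ∫ t in (0:ℝ)..1, ⟪v (c + t • (y - c)), y - c⟫ with hΦ
  have hΦd : ∀ c ∈ C, ∀ x ∈ ball c R, HasFDerivAt (Φ c) (innerSL ℝ (v x)) x :=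
    fun c hc x hx => tautLoopLlc_potential hv (hCS c hc) hx
  set K : E3 → E3 → ℝ := fun c c' => if h : (ball c R ∩ ball c' R).Nonempty then
    Φ c h.some - Φ c' h.some else 0 with hK
  have hKc : ∀ c ∈ C, ∀ c' ∈ C, ∀ p ∈ ball c R ∩ ball c' R, Φ c p = Φ c' p + K c c' := by
    intro c hc c' hc' p hp
    have hne : (ball c R ∩ ball c' R).Nonempty := ⟨p, hp⟩
    have hq := hne.some_mem
    simp only [hK, dif_pos hne]
    have h := tautLoopLlc_potential_sub_const (isOpen_ball.inter isOpen_ball)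
      ((convex_ball c R).inter (convex_ball c' R)) (fun x hx => hΦd c hc x hx.1)
      (fun x hx => hΦd c' hc' x hx.2) hp hq
    linarith
  -- the number of arcs
  set N : ℕ := ⌈ℓ / (R / 3)⌉₊ + 1 with hN
  have hNpos : 0 < N := Nat.succ_pos _
  have hR3 : 0 < R / 3 := by positivity
  have hℓN : ℓ ≤ N * (R / 3) := by
    have h1 : ℓ / (R / 3) ≤ ⌈ℓ / (R / 3)⌉₊ := Nat.le_ceil _
    have h2 : (⌈ℓ / (R / 3)⌉₊ : ℝ) ≤ N := by simp [hN]
    rw [div_le_iff₀ hR3] at h1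
    nlinarith
  refine ⟨Set.range (fun b : Fin (N + 1) → ↥C =>
      ∑ j : Fin N, K (b (Fin.castSucc j)) (b (Fin.succ j))), Set.finite_range _, ?_⟩
  filter_upwards [hnearS] with n hn
  refine tautLoopLlc_circulation_mem_chain hv.continuous C Φ K hΦd hKc hNpos (hγ n)
    (fun s => ?_) ((hℓ n).trans hℓN)
  -- every point of `γ n` is within `d₀/6 = R/3` of a kept centre
  obtain ⟨y, hy, hsy⟩ := hn s
  have hmem : γ n s ∈ closedBall (0:E3) R₀ := mem_closedBall_zero_iff.2 (hR n s)
  obtain ⟨c, hcT, hsc⟩ := mem_iUnion₂.1 (hTcov hmem)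
  rw [mem_ball] at hsc
  refine ⟨c, Finset.mem_filter.2 ⟨hTfin.mem_toFinset.2 hcT, y, hy, ?_⟩, by rw [hRdef]; linarith⟩
  linarith [dist_triangle c (γ n s) y, dist_comm c (γ n s)]

/-- **Tools stub, part 3** (registered as `stub_tautLoopLlcTools3`): quantisation of the
circulations of a confined sequence of loops near which the vorticity dies out, with all binders
explicit. [folklore] -/
theorem stub_tautLoopLlcTools3 :
    ∀ (v : EuclideanSpace ℝ (Fin 3) → EuclideanSpace ℝ (Fin 3)), ContDiff ℝ 1 v → ∀ (γ : ℕ → ℝ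
      → EuclideanSpace ℝ (Fin 3)), (∀ n : ℕ, Literature.Analysis.FluidPDE.IsC1Loop (γ n)) → ∀
      (R₀ ℓ d₀ : ℝ), (∀ (n : ℕ) (s : ℝ), ‖γ n s‖ ≤ R₀) → (∀ n : ℕ, (∫ σ in (0:ℝ)..1, ‖deriv (γ
      n) σ‖) ≤ ℓ) → 0 < d₀ → (∀ w : ℝ, 0 < w → ∀ᶠ n in Filter.atTop, ∀ (x : EuclideanSpace ℝ
      (Fin 3)) (s : ℝ), dist x (γ n s) ≤ d₀ → ‖Literature.Analysis.FluidPDE.curl v x‖ < w) → ∃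
      V : Set ℝ, V.Finite ∧ ∀ᶠ n in Filter.atTop, Literature.Analysis.FluidPDE.circulation v (γ
      n) ∈ V :=
  fun _v hv _γ hγ _R₀ _ℓ _d₀ hR hℓ hd₀ hflat => tautLoopLlc_quantised hv hγ hR hℓ hd₀ hflat

end Summit.NavierStokesRegularity.NavierStokesRegularity.Theorems

end
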